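import Literature.NumberTheory.EllipticCurves.TorsionConductorExponentAdditiveProofs
import Literature.NumberTheory.EllipticCurves.OggFormulaWildThreeProofs
import Literature.NumberTheory.EllipticCurves.DivisionFieldRamificationPrimePowProofs
import Literature.NumberTheory.EllipticCurves.InertiaInvariantsMultiplicativeProofs
import Literature.NumberTheory.EllipticCurves.GoodReductionUnramifiedProofs
import Literature.NumberTheory.GaloisRepresentations.ArtinConductorProofs
import Literature.NumberTheory.DiophantineGeometry.ConductorMultiplicativeProofs
import Literature.NumberTheory.DiophantineGeometry.ConductorExponentZeroProofs
import Literature.NumberTheory.DiophantineGeometry.ConductorRingOfIntegersProofs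
import Literature.NumberTheory.DiophantineGeometry.ConductorFactorizationProofs
import HarnessLib

/-!
# Crux idea `koeta` (item stmt-BirchSwinnertonDyer-20727, crux `AnticyclotomicEisensteinDivisibility`,
# route `SignedBaseChange`) — FIRST LEMMA: no conductor drop for `p ≥ 5` at the WILD additive places
# `v ∣ 6`, (rev 2) at every `v ∤ p` on the all-ramified cell (`a_v(E[p]) = f_v(E)`), i.e. Kim–Ota's
# tame-level clause CR⁺(7) = "`N(ρ̄_{E,p}) = N_E` prime to `p`", kernel-checked modulo Saito at `v ∣ 2`,
# and (rev 3) the same over `ℚ` straight from the route's binder (ii) (the `ℚ/ℤ` place glue done)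

Ideator seat bsd-idea-5 (D-0145, lens «transfer», lane «level-raising / ℓ²-local-condition lever»),
gen 21, 2026-08-29.  PUBLISH-ONLY crux workfile (W-79): written with `ledger crux write`, never
`skeleton check`ed; it is NOT the line of record (`Lines/admdef.lean`, LEAD bsd-line-sbc-p1) and does
not import it.  Theorems only (no `def`, no named fact, no new instance); the one
`attribute [local instance] AddSubgroup.torsionBy.zmodModule` is Mathlib's own `ZMod n`-module
structure on `A[n]`, required for the TYPE of the tree's `WeierstrassCurve.torsionGaloisRep` to
elaborate (exactly as in `TorsionConductorExponentAdditiveProofs`, whose §5 this file extends).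

WHAT THIS IS FOR (card `Ideas/koeta.md`).  On line `admdef`'s residual sub-cell β″ (Addendum (g) of
`Lines/admdef.md`: all primes of `N = N_E` ramified in `ρ̄ = ρ̄_{E,p}`, `N` not square-free, at most one
multiplicative prime) the η-identity `ord_℘ η_{g,N⁺,N⁻} = Σ_{q ∣ N⁻} t_g(q)` for the LEVEL-RAISED newform
`g` of level `N_E·m` (`N⁺ = N_E` arbitrary, `N⁻ = m` admissible) is not available from W. Zhang's proof of
[Zha14, Thm 6.4] (his anchor ♠(2) for the Ribet–Takahashi/Khare degree comparison fails), but it IS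
available ANCHOR-FREE from Kim–Ota [KO23 = arXiv:1905.02926: Thm 1.3 (no hypothesis on `N⁺`; crystalline
weight-2 `R = 𝕋`) + Cor 5.7 under Assumption 5.3 (CR⁺)], where in weight 2 the freeness input Thm 5.5 is
Pollack–Weston 2011 Thm 6.2 (Helm's multiplicity one; no ordinarity, and no square-freeness by Zhang's own
remark p. 229) — so neither ♠(2) nor KO's Rem 5.6(1) is needed.  (For `g = f_E` the tree's audit already
records KO Cor 5.8 as the refereed cover at arbitrary `N⁺`: docstring of
`Literature…WZhang2014.thm64_padicValNat_congruenceNumber_eq`; this card applies it to the level-raised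
`g` and removes the Rem 5.6 caveat in weight 2.)  For `(ρ̄_{E,p}, g, N⁺ = N_E, N⁻ = m)` on cell β with
`p ≥ 5` every clause of CR⁺ is automatic EXCEPT (7) `(N(ρ̄), N_E m / N(ρ̄)) = 1`, which holds iff the
prime-to-`p` conductor `N(ρ̄_{E,p})` keeps the FULL exponent `f_q(E)` at every `q ∣ N_E` (then also `g` is
new of level exactly `N_E m`).  At multiplicative `q` this is the cell hypothesis "ramified"; at additive
`q ∤ 6p` it is the tree's `WeierstrassCurve.artinConductorExponent_torsion_eq_conductorExponent_of_five_le`;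
the present file does the remaining WILD places `q ∈ {2, 3}` — which carry most of β″
(`N = 27, 32, 36, 64, 108, 144, …`):

* `artinConductorAt_torsion_eq_two_add_wildConductorExponent_of_five_le` — `a_𝔓(E[p]) = 2 + δ_v` at an
  additive `v ∤ p`, `p ≥ 5`, granted `Sw_𝔓(E[p]) = δ_v` (codim `E[p]^{I_𝔓} = 2` is the tree's
  `codimFixed_inertia_torsion_eq_two_of_five_le`);
* `artinConductorExponent_torsion_eq_conductorExponent_of_five_le_of_swan` — hence `a_v(E[p]) = f_v(E)`
  (`f_v = ε_v + δ_v`, `ε_v = 2`: `conductorExponent_eq_tameConductorExponent_add_wildConductorExponent_holds`,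
  `KodairaSymbol.tameConductorExponent_eq_two_iff`, `isAdditive_kodairaSymbolAt_iff_holds`);
* `artinConductorExponent_torsion_eq_conductorExponent_of_five_le_of_ringChar_eq_three` —
  **UNCONDITIONAL at `v ∣ 3`**: `Sw_𝔓(E[p]) = Sw_𝔓(V_p E)` (`swanConductorAt_rationalTate_eq_swanConductorAt_torsion`)
  `= δ_v` by Ogg's formula at residue characteristic `3`, PROVED in the tree
  (`swanConductorAt_rationalTate_eq_wildConductorExponent_of_ringChar_eq_three_holds`);
* `artinConductorExponent_torsion_eq_conductorExponent_of_five_le_of_ringChar_eq_two` — at `v ∣ 2`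
  modulo the named fact `swanConductorAt_rationalTate_eq_wildConductorExponent_of_ringChar_eq_two`
  (Saito 1988, Thm 1; hypothesis `hSaito`);
* `artinConductorExponent_torsion_eq_conductorExponent_of_five_le_additive` — ALL additive `v ∤ p`
  together (`p ≥ 5`; Saito at `v ∣ 2` the only non-kernel input).

Rev 2 (same gen, after critic V#27p/V#27q) adds the two remaining kinds of places, so that the whole of
"`N(ρ̄_{E,p}) = N_E` prime to `p`" on the all-ramified cell is kernel-checked modulo Saito at `v ∣ 2`:

* `artinConductorExponent_torsion_eq_conductorExponent_of_hasGoodReductionAt` — `a_v(E[p]) = f_v = 0` at a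
  good `v ∤ p` (torsion Néron–Ogg–Shafarevich, *AEC* VII.4.1(b): `smul_eq_of_mem_inertia_of_nsmul_eq_zero`);
* `codimFixed_inertia_torsion_eq_one_of_hasMultiplicativeReductionAt` — `codim E[p]^{I_𝔓} = 1` at a
  multiplicative `v ∤ p` where some `σ ∈ I_𝔓` moves a `p`-torsion point (the global Tate basis
  `exists_tateBasis_geomTorsion_of_hasMultiplicativeReductionAt` supplies the fixed line);
* `artinConductorExponent_torsion_eq_conductorExponent_of_hasMultiplicativeReductionAt` — hence
  `a_v(E[p]) = f_v = 1` there (`Sw = 0`: `swanConductorAt_rationalTate_eq_zero_of_hasMultiplicativeReductionAt_holds`);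
* `artinConductorExponent_torsion_eq_conductorExponent_of_five_le_of_allRamified` — **`a_v(E[p]) = f_v(E)`
  at EVERY `v ∤ p`** for `p ≥ 5`, granted Saito at `v ∣ 2` and ramification of `E[p]` at the
  multiplicative places (the crux-cell binder (ii) read at `q ∥ N_E`).

Rev 3 (same gen, after critic V#27r listed "ℚ/ℤ place glue (typer)" as the last kernel input on cell β
besides Saito@2) adds the BINDER FORM over `ℚ`:

* `artinConductorExponent_torsion_eq_conductorExponent_rat_of_five_le_of_binder` — for `W/ℚ`, `p ≥ 5`,
  `(N : ℤ) = N_E` and the route's own binder (ii) "`∀ q` prime, `q ∣ N →` ∃ a place `v' ∋ q`, a prime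
  `𝔓 ∣ v'` of `ℚ̄`, `σ ∈ I_𝔓` and `P ∈ E[p](ℚ̄)` with `σ P ≠ P`" (verbatim the conclusion shape of the landed
  `SignedBaseChangeAcDivAdmdefRamifiedNS.allRamified_of_allAdditive`): **`a_v(E[p]) = f_v(E)` at every
  `v ∤ p`**, granted only `hSaito`.  Glue: `f_w = 1` at a multiplicative `w` is the exponent of
  `p_w = natGenerator w` in `N_E` (`conductorExponent_ringOfIntegers_eq`, `factorization_conductorNorm_holds`),
  so `p_w ∣ N`, and the place binder (ii) returns IS `w` (`Rat.HeightOneSpectrum.primesEquiv` is injective).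

So, for an elliptic curve over a number field and `p ≥ 5`: the mod-`p` representation loses NO additive
conductor exponent anywhere (prime to `p`), and on the all-ramified cell it loses nothing at all — KO's
CR⁺(7) for `(ρ̄_{E,p}, N⁺ = N_E)` and "`g` new of level exactly `N_E m`".  Nothing is asserted about any
particular curve or modular form; BSD is not proved by any of this, nor is the crux, C⁺⁺_NS, [NV] or the
η-identity.

References: [KO23] C.-H. Kim, K. Ota, *On the quantitative variation of congruence ideals and integral
periods of modular forms*, Res. Math. Sci. 10 (2023), arXiv:1905.02926, Thm 1.3, Assumption 5.3, Cor 5.7,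
5.8; [Serre1987] §1.2; [SilvermanATAEC1994] §IV.10–11; [Saito1988] Thm 1; [Carayol1989]; tree files
`TorsionConductorExponentAdditiveProofs`, `SwanConductorTorsionProofs`, `OggFormulaWildThreeProofs`,
`ConductorTameWildProofs`, `ConductorRingOfIntegersProofs`, `ConductorFactorizationProofs`.
-/

set_option linter.dupNamespace false

noncomputable section

open scoped Classical NumberField
open Field IsDedekindDomain IsDedekindDomain.HeightOneSpectrum NumberField

attribute [local instance] AddSubgroup.torsionBy.zmodModule

universe u

namespace Summit.BirchSwinnertonDyer.BirchSwinnertonDyer.Cruxes.AnticyclotomicEisensteinDivisibility.Koeta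

open Literature.NumberTheory.EllipticCurves Literature.NumberTheory.GaloisRepresentations
  Literature.NumberTheory.DiophantineGeometry WeierstrassCurve

variable {K : Type u} [Field K] [NumberField K] (W : WeierstrassCurve K)
  {v : HeightOneSpectrum (𝓞 K)}

omit [NumberField K] in
/-- The residue characteristic of `v` is `q` as soon as `q` is a prime lying in `v`. [folklore] -/
theorem ringChar_quotient_eq_of_natCast_mem {q : ℕ} (hq : q.Prime) (h : (q : 𝓞 K) ∈ v.asIdeal) :
    ringChar (𝓞 K ⧸ v.asIdeal) = q := by
  haveI : v.asIdeal.IsPrime := v.isPrime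
  haveI : IsDomain (𝓞 K ⧸ v.asIdeal) := Ideal.Quotient.isDomain v.asIdeal
  have h0 : ((q : ℕ) : 𝓞 K ⧸ v.asIdeal) = 0 := by
    rw [← map_natCast (Ideal.Quotient.mk v.asIdeal), Ideal.Quotient.eq_zero_iff_mem]
    exact h
  exact CharP.ringChar_of_prime_eq_zero hq h0

/-- **`a_𝔓(E[p]) = 2 + δ_v` for `p ≥ 5` at an additive `v ∤ p`, granted `Sw_𝔓(E[p]) = δ_v`.**
`a_𝔓 = codim E[p]^{I_𝔓} + Sw_𝔓(E[p])` (`GaloisRep.artinConductorAt_def`) with codimension `2`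
(`codimFixed_inertia_torsion_eq_two_of_five_le`: `E[p]^{I} = 0`, as `#E[p]^{I} ≤ 4 < p`).
[cite: SerreLocalFields1979, Ch. VI §2, Cor. 1'] [cite: Serre1987, §1.2] -/
theorem artinConductorAt_torsion_eq_two_add_wildConductorExponent_of_five_le [W.IsElliptic]
    {p : ℕ} [Fact p.Prime] (h5 : 5 ≤ p) (hadd : W.HasAdditiveReductionAt v)
    (hpv : (p : 𝓞 K) ∉ v.asIdeal) {𝔓 : Ideal (absIntegers (𝓞 K) K)} (h𝔓 : 𝔓 ∈ v.primesAbove)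
    (hsw : (W.torsionGaloisRep p).swanConductorAt (𝓞 K) 𝔓 = (W.wildConductorExponent v : ℝ)) :
    (W.torsionGaloisRep p).artinConductorAt (𝓞 K) 𝔓 = ((2 + W.wildConductorExponent v : ℕ) : ℝ) := by
  rw [GaloisRep.artinConductorAt_def, W.codimFixed_inertia_torsion_eq_two_of_five_le hadd h5 hpv h𝔓,
    hsw]
  push_cast
  ring

/-- **`a_v(E[p]) = f_v(E)` for `p ≥ 5` at an additive `v ∤ p`, granted `Sw_𝔓(E[p]) = δ_v` at the primes
above `v`**: `a_v = ⌊2 + δ_v⌋ = 2 + δ_v = ε_v + δ_v = f_v`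
(`conductorExponent_eq_tameConductorExponent_add_wildConductorExponent_holds`, `ε_v = 2` at an additive
place). [cite: SilvermanATAEC1994, §IV.10 Definition and Thm. IV.10.2] [cite: Serre1987, §1.2] -/
theorem artinConductorExponent_torsion_eq_conductorExponent_of_five_le_of_swan [W.IsElliptic]
    {p : ℕ} [Fact p.Prime] (h5 : 5 ≤ p) (hadd : W.HasAdditiveReductionAt v)
    (hpv : (p : 𝓞 K) ∉ v.asIdeal)
    (hsw : ∀ ⦃𝔓 : Ideal (absIntegers (𝓞 K) K)⦄, 𝔓 ∈ v.primesAbove →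
      (W.torsionGaloisRep p).swanConductorAt (𝓞 K) 𝔓 = (W.wildConductorExponent v : ℝ)) :
    (W.torsionGaloisRep p).artinConductorExponent v = W.conductorExponent v := by
  haveI : PerfectField (IsLocalRing.ResidueField (v.adicCompletionIntegers K)) :=
    PerfectField.ofFinite
  have h0 := (primesAbove_nonempty v).some_mem
  unfold GaloisRep.artinConductorExponent
  rw [artinConductorAt_torsion_eq_two_add_wildConductorExponent_of_five_le W h5 hadd hpv h0 (hsw h0),
    Nat.floor_natCast, conductorExponent_eq_tameConductorExponent_add_wildConductorExponent_holds v W,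
    (KodairaSymbol.tameConductorExponent_eq_two_iff _).mpr
      ((isAdditive_kodairaSymbolAt_iff_holds v W).mpr hadd)]

/-- **UNCONDITIONAL at `v ∣ 3`: `a_v(E[p]) = f_v(E)` for `p ≥ 5` at an additive place of residue
characteristic `3`.**  `Sw_𝔓(E[p]) = Sw_𝔓(V_p E)` (`swanConductorAt_rationalTate_eq_swanConductorAt_torsion`)
and Ogg's formula at residue characteristic `3`, PROVED in the tree
(`swanConductorAt_rationalTate_eq_wildConductorExponent_of_ringChar_eq_three_holds`), give `Sw = δ_v`.
[cite: SilvermanATAEC1994, Thm. IV.11.1 (Ogg's formula), case p = 3 (PDF pp. 365–371)]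
[cite: Serre1987, §1.2] [cite: Carayol1989, Introduction] -/
theorem artinConductorExponent_torsion_eq_conductorExponent_of_five_le_of_ringChar_eq_three
    [W.IsElliptic] {p : ℕ} [Fact p.Prime] (h5 : 5 ≤ p) (hadd : W.HasAdditiveReductionAt v)
    (hpv : (p : 𝓞 K) ∉ v.asIdeal) (h3 : ringChar (𝓞 K ⧸ v.asIdeal) = 3) :
    (W.torsionGaloisRep p).artinConductorExponent v = W.conductorExponent v := by
  refine artinConductorExponent_torsion_eq_conductorExponent_of_five_le_of_swan W h5 hadd hpv ?_
  intro 𝔓 h𝔓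
  rw [← W.swanConductorAt_rationalTate_eq_swanConductorAt_torsion p
    (W.continuous_rationalGaloisRepTate_holds p) hpv h𝔓]
  exact W.swanConductorAt_rationalTate_eq_wildConductorExponent_of_ringChar_eq_three_holds p
    (W.continuous_rationalGaloisRepTate_holds p) v hpv hadd h3 h𝔓

/-- **At `v ∣ 2` modulo Saito: `a_v(E[p]) = f_v(E)` for `p ≥ 5` at an additive place of residue
characteristic `2`**, granted Ogg's formula there (Saito 1988, the named fact
`swanConductorAt_rationalTate_eq_wildConductorExponent_of_ringChar_eq_two`, hypothesis `hSaito`).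
[cite: Saito1988, Theorem 1] [cite: SilvermanATAEC1994, Thm. IV.11.1] [cite: Serre1987, §1.2] -/
theorem artinConductorExponent_torsion_eq_conductorExponent_of_five_le_of_ringChar_eq_two
    [W.IsElliptic] {p : ℕ} [Fact p.Prime] (h5 : 5 ≤ p)
    (hSaito : W.swanConductorAt_rationalTate_eq_wildConductorExponent_of_ringChar_eq_two p)
    (hadd : W.HasAdditiveReductionAt v) (hpv : (p : 𝓞 K) ∉ v.asIdeal)
    (h2 : ringChar (𝓞 K ⧸ v.asIdeal) = 2) :
    (W.torsionGaloisRep p).artinConductorExponent v = W.conductorExponent v := by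
  refine artinConductorExponent_torsion_eq_conductorExponent_of_five_le_of_swan W h5 hadd hpv ?_
  intro 𝔓 h𝔓
  rw [← W.swanConductorAt_rationalTate_eq_swanConductorAt_torsion p
    (W.continuous_rationalGaloisRepTate_holds p) hpv h𝔓]
  exact hSaito (W.continuous_rationalGaloisRepTate_holds p) v hpv hadd h2 h𝔓

/-- **No conductor drop for `p ≥ 5` at ANY additive place `v ∤ p`** (Saito's theorem at `v ∣ 2` the only
non-kernel input): for `E/K` elliptic over a number field, a prime `p ≥ 5` and a place `v ∤ p` of
additive reduction, `a_v(E[p]) = f_v(E)`.  Cases: `v ∣ 2` (`…_of_ringChar_eq_two`, uses `hSaito`),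
`v ∣ 3` (`…_of_ringChar_eq_three`, unconditional), `v ∤ 6` (the tree's
`WeierstrassCurve.artinConductorExponent_torsion_eq_conductorExponent_of_five_le`).  This is the additive
half of "`N(ρ̄_{E,p}) = N_E` prime to `p`" — Kim–Ota's Assumption 5.3 (7) for `(ρ̄_{E,p}, N⁺ = N_E)` — the
multiplicative half being "`ρ̄` ramified at every `q ∥ N_E`".
[cite: Serre1987, §1.2 and §4] [cite: Carayol1989, Introduction] [cite: Saito1988, Theorem 1]
[cite: KimOta2023, Assumption 5.3 (7)] -/
theorem artinConductorExponent_torsion_eq_conductorExponent_of_five_le_additive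
    [W.IsElliptic] {p : ℕ} [Fact p.Prime] (h5 : 5 ≤ p)
    (hSaito : W.swanConductorAt_rationalTate_eq_wildConductorExponent_of_ringChar_eq_two p)
    (hadd : W.HasAdditiveReductionAt v) (hpv : (p : 𝓞 K) ∉ v.asIdeal) :
    (W.torsionGaloisRep p).artinConductorExponent v = W.conductorExponent v := by
  by_cases h2 : (2 : 𝓞 K) ∈ v.asIdeal
  · exact artinConductorExponent_torsion_eq_conductorExponent_of_five_le_of_ringChar_eq_two W h5
      hSaito hadd hpv (ringChar_quotient_eq_of_natCast_mem Nat.prime_two (by exact_mod_cast h2))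
  by_cases h3 : (3 : 𝓞 K) ∈ v.asIdeal
  · exact artinConductorExponent_torsion_eq_conductorExponent_of_five_le_of_ringChar_eq_three W h5
      hadd hpv (ringChar_quotient_eq_of_natCast_mem Nat.prime_three (by exact_mod_cast h3))
  · exact W.artinConductorExponent_torsion_eq_conductorExponent_of_five_le hadd h5 hpv h2 h3


/-! ## rev 2 (g21, after critic V#27p/q): the GOOD and MULTIPLICATIVE places — `N(ρ̄_{E,p}) = N_E`
prime to `p`, exponentwise, on the all-ramified cell (Kim–Ota CR⁺(7) input, typed and proved modulo
Saito at `v ∣ 2`) -/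

/-- **`a_v(E[p]) = f_v(E) = 0` at a place `v ∤ p` of good reduction** (any prime `p`): `E[p]` is
unramified at `v` (Silverman *AEC* VII.4.1(b) for the `p`-torsion, the tree's
`smul_eq_of_mem_inertia_of_nsmul_eq_zero`), so `a_v = 0`
(`GaloisRep.artinConductorExponent_eq_zero_of_isUnramifiedAt_holds`), and `f_v = 0`
(`conductorExponent_eq_zero_iff_holds`).
[cite: SilvermanAEC2009, Prop. VII.4.1(b)] [cite: SerreLocalFields1979, Ch. VI §2, Thm 1'] -/
theorem artinConductorExponent_torsion_eq_conductorExponent_of_hasGoodReductionAt [W.IsElliptic]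
    {p : ℕ} [Fact p.Prime] (hgood : W.HasGoodReductionAt v) (hpv : (p : 𝓞 K) ∉ v.asIdeal) :
    (W.torsionGaloisRep p).artinConductorExponent v = W.conductorExponent v := by
  haveI : PerfectField (IsLocalRing.ResidueField (v.adicCompletionIntegers K)) :=
    PerfectField.ofFinite
  have hunr : (W.torsionGaloisRep p).IsUnramifiedAt v := by
    intro 𝔓 h𝔓 τ hτ
    refine LinearMap.ext fun P ↦ Subtype.ext ?_
    have hP : p • (P : geomPoints W) = 0 := by
      have h' := (mem_geomTorsion_iff W ((p : ℕ) : ℤ) (P : geomPoints W)).mp P.2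
      rwa [natCast_zsmul] at h'
    exact W.smul_eq_of_mem_inertia_of_nsmul_eq_zero hgood hpv h𝔓 hτ hP
  rw [GaloisRep.artinConductorExponent_eq_zero_of_isUnramifiedAt_holds hunr,
    (conductorExponent_eq_zero_iff_holds v W).mpr hgood]

/-- **`codim E[p]^{I_𝔓} = 1` at a multiplicative place `v ∤ p` where `E[p]` is ramified at `𝔓`.**
The global Tate basis (`exists_tateBasis_geomTorsion_of_hasMultiplicativeReductionAt`, Silverman
*ATAEC* V.4–V.5: `I_𝔓` fixes `P₁ ≠ O` and moves `P₂` into `ℕ P₁`) gives an inertia-fixed LINE, and the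
ramification hypothesis says the fixed space is not everything; `dim_{𝔽_p} E[p] = 2`.
[cite: SilvermanATAEC1994, V.4–V.5 and Exercise 5.13(b)] [cite: Serre1987, §1.2] -/
theorem codimFixed_inertia_torsion_eq_one_of_hasMultiplicativeReductionAt [W.IsElliptic]
    {p : ℕ} [Fact p.Prime] (hmult : W.HasMultiplicativeReductionAt v) (hpv : (p : 𝓞 K) ∉ v.asIdeal)
    {𝔓 : Ideal (absIntegers (𝓞 K) K)} (h𝔓 : 𝔓 ∈ v.primesAbove)
    (hram : ∃ σ ∈ 𝔓.inertia (absoluteGaloisGroup K), ∃ P : geomTorsion W (p : ℤ), σ • P ≠ P) :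
    (W.torsionGaloisRep p).codimFixed (𝔓.inertia (absoluteGaloisGroup K)) = 1 := by
  have hp : p.Prime := Fact.out
  haveI : Finite (geomTorsion W ((p : ℕ) : ℤ)) := W.finite_geomTorsion_nat hp.ne_zero
  haveI : Module.Finite (ZMod p) (geomTorsion W ((p : ℕ) : ℤ)) := Module.Finite.of_finite
  have h2 : Module.finrank (ZMod p) (geomTorsion W ((p : ℕ) : ℤ)) = 2 :=
    W.finrank_geomTorsion_eq_two p (by exact_mod_cast hp.ne_zero)
  set F := (W.torsionGaloisRep p).fixedSubmodule (𝔓.inertia (absoluteGaloisGroup K)) with hF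
  -- the inertia-fixed Tate vector `P₁ ≠ O` of `E[p]`
  obtain ⟨P₁, P₂, hP₁0, -, hI⟩ :=
    W.exists_tateBasis_geomTorsion_of_hasMultiplicativeReductionAt hmult hp hpv (le_refl 1) h𝔓
  have hp1 : ((p ^ 1 : ℕ) : ℤ) = ((p : ℕ) : ℤ) := by rw [pow_one]
  -- work with the underlying geometric point `G = P₁ ∈ E(K̄)` (its subtype depends on the level)
  obtain ⟨G, hG⟩ : ∃ G : geomPoints W, (P₁ : geomPoints W) = G := ⟨_, rfl⟩
  have hP₁mem : G ∈ geomTorsion W ((p : ℕ) : ℤ) := by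
    have h' : ((p ^ 1 : ℕ) : ℤ) • (P₁ : geomPoints W) = 0 :=
      (mem_geomTorsion_iff W ((p ^ 1 : ℕ) : ℤ) (P₁ : geomPoints W)).mp P₁.2
    rw [hG] at h'
    rw [hp1] at h'
    exact (mem_geomTorsion_iff W ((p : ℕ) : ℤ) G).mpr h'
  have hP₁ne : G ≠ 0 := by
    intro h0
    apply hP₁0
    have h1 : P₁ = 0 := Subtype.ext (hG.trans h0)
    rw [h1]
    exact smul_zero _
  have hQF : (⟨G, hP₁mem⟩ : geomTorsion W ((p : ℕ) : ℤ)) ∈ F := by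
    rw [hF, mem_fixedSubmodule_torsionGaloisRep_iff]
    intro σ hσ
    show σ • G = G
    rw [← hG]
    exact congrArg Subtype.val (hI σ hσ).1
  have hFbot : F ≠ ⊥ := by
    intro h
    rw [h, Submodule.mem_bot] at hQF
    exact hP₁ne (congrArg Subtype.val hQF)
  have hFtop : F ≠ ⊤ := by
    obtain ⟨σ, hσ, P, hP⟩ := hram
    intro h
    apply hP
    have hPF : P ∈ F := h ▸ Submodule.mem_top
    rw [hF, mem_fixedSubmodule_torsionGaloisRep_iff] at hPF
    exact Subtype.ext (hPF σ hσ)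
  have hle : Module.finrank (ZMod p) F ≤ 2 := h2 ▸ Submodule.finrank_le F
  have hne0 : Module.finrank (ZMod p) F ≠ 0 := fun h ↦ hFbot (Submodule.finrank_eq_zero.mp h)
  have hne2 : Module.finrank (ZMod p) F ≠ 2 := fun h ↦
    hFtop (Submodule.eq_top_of_finrank_eq (h.trans h2.symm))
  have h := ContinuousRep.codimFixed_eq_finrank_sub (W.torsionGaloisRep p)
    (𝔓.inertia (absoluteGaloisGroup K))
  rw [h2] at h
  rw [h]
  change 2 - Module.finrank (ZMod p) F = 1
  omega

/-- **`a_v(E[p]) = f_v(E) = 1` at a multiplicative place `v ∤ p` where `E[p]` is RAMIFIED** (some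
inertia element at some prime above `v` moves a `p`-torsion point — the all-ramified cell's hypothesis
(ii) at `q ∥ N_E`): `a_𝔓 = codim + Sw = 1 + 0` (`codimFixed_inertia_torsion_eq_one_of_hasMultiplicativeReductionAt`;
`Sw_𝔓(E[p]) = Sw_𝔓(V_p E) = 0`, `swanConductorAt_rationalTate_eq_swanConductorAt_torsion` and
`swanConductorAt_rationalTate_eq_zero_of_hasMultiplicativeReductionAt_holds`), independence of the prime
above `v` (`GaloisRep.artinConductorAt_eq_of_mem_primesAbove_holds`), and `f_v = 1`
(`conductorExponent_eq_one_iff_holds`).  Without "ramified" the exponent can DROP to `0`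
(`p ∣ ord_v Δ_min`: level lowering), which is exactly what cell β excludes.
[cite: SilvermanATAEC1994, Thm. IV.10.2(b), multiplicative case] [cite: Serre1987, §1.2 and §4]
[cite: KimOta2023, Assumption 5.3 (7)] -/
theorem artinConductorExponent_torsion_eq_conductorExponent_of_hasMultiplicativeReductionAt
    [W.IsElliptic] {p : ℕ} [Fact p.Prime] (hmult : W.HasMultiplicativeReductionAt v)
    (hpv : (p : 𝓞 K) ∉ v.asIdeal)
    (hram : ∃ 𝔓 ∈ v.primesAbove, ∃ σ ∈ 𝔓.inertia (absoluteGaloisGroup K),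
      ∃ P : geomTorsion W (p : ℤ), σ • P ≠ P) :
    (W.torsionGaloisRep p).artinConductorExponent v = W.conductorExponent v := by
  haveI : PerfectField (IsLocalRing.ResidueField (v.adicCompletionIntegers K)) :=
    PerfectField.ofFinite
  obtain ⟨𝔓, h𝔓, hσ⟩ := hram
  have h0 := (primesAbove_nonempty v).some_mem
  unfold GaloisRep.artinConductorExponent
  rw [GaloisRep.artinConductorAt_eq_of_mem_primesAbove_holds h0 h𝔓 (W.torsionGaloisRep p),
    GaloisRep.artinConductorAt_def,
    codimFixed_inertia_torsion_eq_one_of_hasMultiplicativeReductionAt W hmult hpv h𝔓 hσ,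
    ← W.swanConductorAt_rationalTate_eq_swanConductorAt_torsion p
      (W.continuous_rationalGaloisRepTate_holds p) hpv h𝔓,
    W.swanConductorAt_rationalTate_eq_zero_of_hasMultiplicativeReductionAt_holds p
      (W.continuous_rationalGaloisRepTate_holds p) v hpv hmult h𝔓,
    (conductorExponent_eq_one_iff_holds v W).mpr hmult]
  simp

/-- **No conductor drop anywhere prime to `p` on the all-ramified cell: `a_v(E[p]) = f_v(E)` for EVERY
`v ∤ p`**, for `E/K` elliptic over a number field and a prime `p ≥ 5`, granted (a) Saito's theorem at
`v ∣ 2` (named fact `hSaito`) and (b) the cell hypothesis that `E[p]` is ramified at every MULTIPLICATIVE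
place `v ∤ p`.  Trichotomy: good (`…_of_hasGoodReductionAt`), multiplicative
(`…_of_hasMultiplicativeReductionAt`), additive (`…_of_five_le_additive`).  Over `ℚ`, (b) is implied by the
crux-cell binder "(ii) `∀ q ∣ N` prime, `∃ v ∋ q, ∃ 𝔓 ∣ v, ∃ σ ∈ I_𝔓, ∃ P ∈ E[p], σ P ≠ P`" (the place of
`ℚ` containing `q` is unique and `q ∥ N_E` at a multiplicative `q`), so this is exactly
"`N(ρ̄_{E,p}) = N_E` prime to `p`" = Kim–Ota's Assumption 5.3 (7) for `(ρ̄_{E,p}, N⁺ = N_E)` (with their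
convention `c(p) = 0`), and "`g` is new of level exactly `N_E m`" for the level-raised `g`.
[cite: Serre1987, §1.2 and §4] [cite: Carayol1989, Introduction] [cite: Saito1988, Theorem 1]
[cite: KimOta2023, Assumption 5.3 (7) and §1.2 (c(ℓ) = ord_ℓ N(ρ̄), c(p) = 0)] -/
theorem artinConductorExponent_torsion_eq_conductorExponent_of_five_le_of_allRamified
    [W.IsElliptic] {p : ℕ} [Fact p.Prime] (h5 : 5 ≤ p)
    (hSaito : W.swanConductorAt_rationalTate_eq_wildConductorExponent_of_ringChar_eq_two p)
    (hram : ∀ v : HeightOneSpectrum (𝓞 K), W.HasMultiplicativeReductionAt v →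
      (p : 𝓞 K) ∉ v.asIdeal →
      ∃ 𝔓 ∈ v.primesAbove, ∃ σ ∈ 𝔓.inertia (absoluteGaloisGroup K),
        ∃ P : geomTorsion W (p : ℤ), σ • P ≠ P)
    (hpv : (p : 𝓞 K) ∉ v.asIdeal) :
    (W.torsionGaloisRep p).artinConductorExponent v = W.conductorExponent v := by
  rcases hasGoodReductionAt_or_hasMultiplicativeReductionAt_or_hasAdditiveReductionAt v W with
    hg | hm | ha
  · exact artinConductorExponent_torsion_eq_conductorExponent_of_hasGoodReductionAt W hg hpv
  · exact artinConductorExponent_torsion_eq_conductorExponent_of_hasMultiplicativeReductionAt W hm hpv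
      (hram v hm hpv)
  · exact artinConductorExponent_torsion_eq_conductorExponent_of_five_le_additive W h5 hSaito ha hpv

/-! ## Binder form over `ℚ`: the crux cell's hypothesis (ii) feeds the all-ramified theorem (`N(ρ̄_{E,p}) = N_E` off `p`) -/

/-- **Over `ℚ`, on the crux cell: `a_v(E[p]) = f_v(E)` at every finite place `v ∤ p` (`p ≥ 5`), i.e.
`N(ρ̄_{E,p}) = N_E` prime to `p` — from the ROUTE'S OWN binder (ii)** "every prime `q ∣ N` (`(N : ℤ) = N_E`)
lies in a place `v' ∋ q` with an inertia element at a prime `𝔓 ∣ v'` of `ℚ̄` moving a geometric `p`-torsion point"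
(the shape of `SignedBaseChangeAcDivAdmdefRamifiedNS.allRamified_of_allAdditive`'s conclusion and of the LEAD's
C⁺⁺ binder), granted Saito's theorem at `2` (named fact `hSaito`).  The `ℚ/ℤ` place glue: at a multiplicative
place `w ∤ p` of `𝓞 ℚ`, `f_w = 1` (`conductorExponent_eq_one_iff_holds`) is the exponent of `p_w = natGenerator w`
in `N_E` (`conductorExponent_ringOfIntegers_eq` + `factorization_conductorNorm_holds`), so `p_w ∣ N`; binder (ii)
at `q = p_w` returns a place `v' ∋ p_w`, and `v' = w` because a place of `ℚ` is determined by the prime it contains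
(`Rat.HeightOneSpectrum.primesEquiv`).  This is the typer-level glue the critic (V#27r) listed as the last kernel
input on cell β besides Saito@2. [cite: Serre1987, §1.2 and §4] [cite: Saito1988, Theorem 1]
[cite: KimOta2023, Assumption 5.3 (7)] [cite: SilvermanAEC2009, C.16] -/
theorem artinConductorExponent_torsion_eq_conductorExponent_rat_of_five_le_of_binder
    (W : WeierstrassCurve ℚ) [W.IsElliptic] {p : ℕ} [Fact p.Prime] (h5 : 5 ≤ p)
    (hSaito : W.swanConductorAt_rationalTate_eq_wildConductorExponent_of_ringChar_eq_two p)
    {N : ℕ} (hN : (N : ℤ) = W.conductorNorm ℤ)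
    (hii : ∀ q : ℕ, q.Prime → q ∣ N →
      ∃ v' : IsDedekindDomain.HeightOneSpectrum (NumberField.RingOfIntegers ℚ),
        ((q : ℕ) : NumberField.RingOfIntegers ℚ) ∈ v'.asIdeal ∧ ∃ 𝔓 ∈ v'.primesAbove,
          ∃ σ ∈ 𝔓.inertia (Field.absoluteGaloisGroup ℚ), ∃ P : W.geomTorsion (p : ℤ), σ • P ≠ P)
    {v : HeightOneSpectrum (𝓞 ℚ)} (hpv : ((p : ℕ) : 𝓞 ℚ) ∉ v.asIdeal) :
    (W.torsionGaloisRep p).artinConductorExponent v = W.conductorExponent v := by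
  refine artinConductorExponent_torsion_eq_conductorExponent_of_five_le_of_allRamified W h5 hSaito
    (fun w hmult _ ↦ ?_) hpv
  -- `q := p_w`, the prime under the multiplicative place `w`
  have hq : (Rat.HeightOneSpectrum.natGenerator w).Prime := Rat.HeightOneSpectrum.prime_natGenerator w
  -- `f_w = 1`, transported to the place of `ℤ` under the same prime, is the exponent of `q` in `N_E`
  have hf1 : W.conductorExponent w = 1 := (conductorExponent_eq_one_iff_holds w W).mpr hmult
  set wZ : HeightOneSpectrum ℤ :=
    (Rat.HeightOneSpectrum.primesEquiv (R := ℤ)).symm (Rat.HeightOneSpectrum.primesEquiv w) with hwZ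
  have hgen : Rat.HeightOneSpectrum.natGenerator wZ = Rat.HeightOneSpectrum.natGenerator w :=
    congrArg Subtype.val
      ((Rat.HeightOneSpectrum.primesEquiv (R := ℤ)).apply_symm_apply (Rat.HeightOneSpectrum.primesEquiv w))
  have hfZ : W.conductorExponent wZ = 1 := by
    rw [← hf1]; exact (W.conductorExponent_ringOfIntegers_eq w).symm
  have hfac : (W.conductorNorm ℤ).factorization (Rat.HeightOneSpectrum.natGenerator w) = 1 := by
    rw [← hgen, W.factorization_conductorNorm_holds wZ, hfZ]
  have hqN : Rat.HeightOneSpectrum.natGenerator w ∣ N := by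
    have hN' : (W.conductorNorm ℤ : ℕ) = N := by exact_mod_cast hN.symm
    rw [← hN']
    exact Nat.dvd_of_factorization_pos (by rw [hfac]; exact one_ne_zero)
  -- binder (ii) at `q`; the place it returns is `w`
  obtain ⟨v', hqv', h𝔓⟩ := hii _ hq hqN
  have hdvd : Rat.HeightOneSpectrum.natGenerator v' ∣ Rat.HeightOneSpectrum.natGenerator w := by
    rw [Rat.HeightOneSpectrum.natGenerator_dvd_iff,
      ← map_natCast (Rat.IsIntegralClosure.intEquiv (𝓞 ℚ)), Ideal.apply_mem_of_equiv_iff]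
    exact hqv'
  have hv'w : v' = w :=
    (Rat.HeightOneSpectrum.primesEquiv (R := 𝓞 ℚ)).injective
      (Subtype.ext ((Nat.prime_dvd_prime_iff_eq (Rat.HeightOneSpectrum.prime_natGenerator v') hq).mp hdvd))
  subst hv'w
  exact h𝔓

end Summit.BirchSwinnertonDyer.BirchSwinnertonDyer.Cruxes.AnticyclotomicEisensteinDivisibility.Koeta

end
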